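import Summits.BirchSwinnertonDyer.BirchSwinnertonDyer.Theorems.ManinLocalTwoThreeManinOddAtFour
import Summits.BirchSwinnertonDyer.BirchSwinnertonDyer.Theorems.ManinLocalTwoThreeStevensCuspInvGaloisAction
import HarnessLib

/-!
# C2 `ManinOddAtFour` ⟸ CDT ALONE (route ManinLocalTwoThree)

The C2 closer of record `maninLocalTwoThree_maninOddAtFour_of_CDT_of_cuspInvGaloisAction` (p763620) takes two named published facts:
`CalegariDimitrovTang2025_unboundedDenominators` (CDT) and Stevens 1982 Thm 1.3.1 (b) in its `Aut_ℚ(ℂ)` form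
`optimalGamma1Parametrization_cuspInv_galoisAction` (T-es-75).  The second is now a THEOREM of the tree
(`ManinLocalTwoThree.StevensGalois.optimalGamma1Parametrization_cuspInv_galoisAction_holds`, proved analytically from the Galois action on the
`q_N`-expansions of `SL₂(ℤ)`-translates of forms on `Γ(N)` and the x/y-presentations of `℘_{Λ}(ℰ_f)`, `℘'_{Λ}(ℰ_f)` by `Γ₁(N)`-forms with rational
expansions), so C2 holds modulo CDT alone.  CONDITIONAL on CDT; BSD is NOT proved by this.
[cite: Stevens1982, §1.3 Thm. 1.3.1 (b) (p. 13)] [cite: CalegariDimitrovTang2025, Thm. 1.0.1]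
-/

namespace Summit.BirchSwinnertonDyer.BirchSwinnertonDyer.Theorems

/-- **C2 `ManinOddAtFour` modulo CDT alone**: the unbounded-denominators theorem of Calegari–Dimitrov–Tang implies that the Manin constant of a
`Γ₀(N)`-parametrisation whose lattice is `c` times (a sublattice of) the period lattice is odd whenever `4 ∣ N`.  Obtained from the closer of record
by discharging its Stevens hypothesis with `StevensGalois.optimalGamma1Parametrization_cuspInv_galoisAction_holds`.  CONDITIONAL (on CDT only). -/
theorem maninLocalTwoThree_maninOddAtFour_of_CDT
    (hCDT : Literature.NumberTheory.Automorphic.CalegariDimitrovTang2025_unboundedDenominators) :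
    Summit.BirchSwinnertonDyer.BirchSwinnertonDyer.Theses.ManinLocalTwoThree.ManinOddAtFour :=
  maninLocalTwoThree_maninOddAtFour_of_CDT_of_cuspInvGaloisAction hCDT
    ManinLocalTwoThree.StevensGalois.optimalGamma1Parametrization_cuspInv_galoisAction_holds

end Summit.BirchSwinnertonDyer.BirchSwinnertonDyer.Theorems
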